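import Summits.QuantumFields.GaugeBoot.Rows.AggBindKit4R
import Summits.QuantumFields.GaugeBoot.MMRowSU2
import HarnessLib

/-!
# Gauge-boot: binding kit for AGGREGATED equality rows in `D = 3` with integer numerators (`…_of_feasible_agg` certificates, 0.10 shape)

Cell `pub-gaugeboot` (HOME `run/shared/lean/pub/pub-gaugeboot/`), seat lean1 (torus bindings; kz-L2-rp-3D rows C15–C19 / C34–C40,
GO-RP3D).

HONEST FRAMING (page 1 of every file of this cell): certified bounds on lattice expectations at STATED coupling,
gauge group, dimension and torus size; NOT a mass gap, NOT a continuum limit, NOT a string tension, NOT large `N`.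
The venture is explicitly NOT Yang–Mills-summit-bearing (barriers `FixedCouplingUltralocality`,
`PerturbativeInvisibility`).

The `D = 3` companion of `AggBindKit4` / `AggBindKit4R`: lean3's 0.10 certificate halves in aggregated form
(`Certificates/KZL2rpD3b<tag>{Up,Lo}`, `var_le/ge_of_feasible_agg`) consume ONE hypothesis `Σ_v aggRow v · y v = aggRhs` with
`aggRow v = RN[v] / RD` over ALL `n` columns (`RN : List ℤ`), while lean2's `D = 3` aggregated rows (`Eqs/KZL2rpD3Z<tag>{U,L}`,
`rowSum_row`) are INTEGER-CODED (`m` terms `(label code, z)`, coefficient `z / M`, `BindZ.decWZ 3`).  The kernel walks are the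
`D`-independent ones of `AggBindKit4` (`rnWalk`, `tsWalk4`, `colOK`; range-chunked in `AggBindKit4R`); this file only supplies the
`D = 3` valuation lemmas `sum_decWZ3` and `sum_eq_of_walks3` (labels decode through lean2's `BindN.wdg 3`; the proof is that of
`sum_eq_of_walks4` verbatim with `4 ↦ 3`).  [folklore]
-/

noncomputable section

open Literature.MathematicalPhysics.QuantumFieldTheory
open Finset

namespace Summit.QuantumFields.GaugeBoot

namespace AggBind4

/-- The value of lean2's decoded row (`c1` components vanish), `D = 3`. [folklore] -/
theorem sum_decWZ3 (f : Word 3 → ℝ) (cβ : ℝ) (M : ℕ) : ∀ ts : List (ℕ × ℤ),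
    ((BindZ.decWZ 3 ts M).map fun t => (((t.2.1 : ℚ) : ℝ) + ((t.2.2 : ℚ) : ℝ) * cβ) * f t.1).sum =
      (ts.map fun t => ((t.2 : ℝ) / M) * f (BindN.wdg 3 t.1)).sum
  | [] => by simp [BindZ.decWZ]
  | t :: ts => by
    have ih := sum_decWZ3 f cβ M ts
    simp only [BindZ.decWZ, List.map_cons, List.sum_cons, List.map_map, Function.comp_def] at ih ⊢
    rw [ih]; push_cast; ring

/-- **From the three linear walks to lean3's aggregated equality (`D = 3`).**  `RN` = lean3's numerators (all `n` columns),
`RD > 0` its denominator, `ts` = lean2's `m` coded terms with denominator `M > 0`; labels decode through `BindN.wdg 3`; lean2's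
decoded row vanishes at the valuation `f`.  Then `Σ_{v<n} (RN[v]/RD) · f (lab v) = 0`.  [folklore] -/
theorem sum_eq_of_walks3 {n : ℕ} {code : ℕ → ℕ} {lab : ℕ → Word 3} (hlab : ∀ v < n, lab v = BindN.wdg 3 (code v))
    (f : Word 3 → ℝ) (cβ : ℝ) {RN : List ℤ} {RD M : ℕ} (hRD : 0 < RD) (hM : 0 < M) {ts : List (ℕ × ℤ)}
    {rn : ℕ → ℤ} {col pos : ℕ → ℕ}
    (hlen : RN.length = n) (hrn : rnWalk rn 0 RN = true) (hts : tsWalk4 n code rn col M RD 0 ts = true)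
    (hcol : colOK n ts.length rn col pos = true)
    (hE : ((BindZ.decWZ 3 ts M).map fun t => (((t.2.1 : ℚ) : ℝ) + ((t.2.2 : ℚ) : ℝ) * cβ) * f t.1).sum = 0) :
    ∑ v : Fin n, ((RN.getD v.val 0 : ℤ) : ℝ) / (RD : ℝ) * f (lab v.val) = 0 := by
  classical
  set m := ts.length with hm
  have hRD' : (RD : ℝ) ≠ 0 := by exact_mod_cast hRD.ne'
  -- lean3's side through `rn`
  have hget : ∀ v : Fin n, RN.getD v.val 0 = rn v.val := fun v => by
    have := getD_of_rnWalk rn 0 RN hrn v.val (by rw [hlen]; exact v.isLt); simpa using this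
  simp_rw [hget]
  -- columns: `col` is an injection `Fin m → Fin n` covering the support of `rn`
  simp only [colOK, Bool.and_eq_true, List.all_eq_true, List.mem_range, Bool.or_eq_true, decide_eq_true_eq] at hcol
  obtain ⟨hcover, hinj⟩ := hcol
  have hclt : ∀ j < m, col j < n := fun j hj => by
    have := col_lt_of_tsWalk4 code rn col M RD 0 ts hts j hj; simpa using this
  let colF : Fin m → Fin n := fun j => ⟨col j.val, hclt j.val j.isLt⟩
  have hcinj : Function.Injective colF := by
    intro a b h
    have h' : col a.val = col b.val := by simpa [colF] using congrArg Fin.val h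
    have := hinj a.val a.isLt; have := hinj b.val b.isLt
    apply Fin.ext
    calc a.val = pos (col a.val) := (hinj a.val a.isLt).symm
      _ = pos (col b.val) := by rw [h']
      _ = b.val := hinj b.val b.isLt
  have hsum : ∑ v : Fin n, ((rn v.val : ℤ) : ℝ) / RD * f (lab v.val) = ∑ j : Fin m, ((rn (col j.val) : ℤ) : ℝ) / RD * f (lab (col j.val)) := by
    have himg : ∑ j : Fin m, ((rn (col j.val) : ℤ) : ℝ) / RD * f (lab (col j.val)) =
        ∑ v ∈ (univ : Finset (Fin m)).image colF, ((rn v.val : ℤ) : ℝ) / RD * f (lab v.val) := by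
      rw [Finset.sum_image fun a _ b _ h => hcinj h]
    rw [himg]
    symm
    refine Finset.sum_subset (Finset.subset_univ _) fun v _ hv => ?_
    have hz : rn v.val = 0 := by
      rcases hcover v.val v.isLt with h | ⟨hp, hc⟩
      · exact h
      · exfalso; exact hv (Finset.mem_image.mpr ⟨⟨pos v.val, hp⟩, Finset.mem_univ _, Fin.ext hc⟩)
    simp [hz]
  rw [hsum]
  -- lean2's side
  rw [sum_decWZ3] at hE
  have hts' := map_eq_of_tsWalk4 code rn col hM hRD (fun c q => q * f (BindN.wdg 3 c)) 0 ts hts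
  rw [hts', ← hm, ← List.range_eq_range', SymB4.sum_map_range] at hE
  rw [Fin.sum_univ_eq_sum_range (fun j => ((rn (col j) : ℤ) : ℝ) / RD * f (lab (col j))) m, ← hE]
  refine Finset.sum_congr rfl fun j hj => ?_
  rw [hlab (col j) (hclt j (Finset.mem_range.mp hj))]

/-- **The same, in lean2's `D = 3` row language**: if lean2's `rowSum β L (BindZ.decWZ 3 ts M) = 0` (`Eqs/…Z<tag>{U,L}.rowSum_row`),
then `Σ_{v<n} (RN[v]/RD) · Rung0D3.W β L (lab v) = 0`.  [folklore] -/
theorem sum_eq_of_walks3_rowSum {n : ℕ} {code : ℕ → ℕ} {lab : ℕ → Word 3} (hlab : ∀ v < n, lab v = BindN.wdg 3 (code v))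
    (β : ℝ) (L : ℕ) [NeZero L] {RN : List ℤ} {RD M : ℕ} (hRD : 0 < RD) (hM : 0 < M) {ts : List (ℕ × ℤ)}
    {rn : ℕ → ℤ} {col pos : ℕ → ℕ}
    (hlen : RN.length = n) (hrn : rnWalk rn 0 RN = true) (hts : tsWalk4 n code rn col M RD 0 ts = true)
    (hcol : colOK n ts.length rn col pos = true)
    (hE : rowSum β L (BindZ.decWZ 3 ts M) = 0) :
    ∑ v : Fin n, ((RN.getD v.val 0 : ℤ) : ℝ) / (RD : ℝ) * Rung0D3.W β L (lab v.val) = 0 :=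
  sum_eq_of_walks3 hlab (Rung0D3.W β L) (β / 8) hRD hM hlen hrn hts hcol (by simpa only [rowSum] using hE)

end AggBind4

end Summit.QuantumFields.GaugeBoot

end
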